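import Summits.QuantumFields.YangMills.Theorems.UnitScaleTiltHalvingHSiteTopReads
import Summits.QuantumFields.YangMills.Theorems.UnitScaleTiltHalvingP1FlatCoreSupplierLandau
import Literature.Analysis.Complex.RungeUnits
import HarnessLib

/-!
# `hP1room` PROGRAMME (LEAD-H «H = hSupUρ3 ⟸ hMember», (K-site) gap (G5)): ★★ THE NEAR-`1` OF THE FULLY GAUGE-FIXED TORUS FIELD BY THE TOP CUBE AT SCALE `L^{−k}` —
# the `hWf1` input of ✓p645668 `P1FlatCoreTopH42.H42_top_guarded` for `Wf := (U♯)^{g′}`, `g′` the composite of the full gauge `u₁·e^{iλ′}`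

Route `UnitScaleTilt`, crux K1 child «MinimiserStabilityRegPr» (stmt-QuantumFields-19200), registered stub `stub_halvingStep` (`BirthV10`).  Cell `ym3-torus` (HUMAN RULING
D-0037: YM₃ on T³ is ladder rung R3 — NOT d = 4, NOT a mass gap, NOT the Clay problem), width seat `ym-ust-20520-w3` gen 6.  `--supports stmt-QuantumFields-19200 --as helper`;
THEOREMS ONLY (0 `def`, 0 `sorry`); count-neutral; nothing here claims `core′`, `hP1room(ρ3)`, `hSupU(ρ3)`, the stub, the crux or the gap.

WHY.  ✓p654113 `siteSizeRows_of_topRows` displays `H42` at `Lan := IsLandau138W ∧ Q`; (K-final) discharges it by ✓p645668 `H42_top_guarded`, whose torus input `hWf1` asks the knit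
field `Wf` to be within `r` of `1` on the bonds around the top blocks WITH `2r ≤ α₂·L^{−k}` — a bound at SCALE `L^{−k}`.  The crude near-`1` of ✓p643987
`norm_mgauge_gaugeFixed_sub_one_le` (`e^{2α₄ + c} − 1`, used for the door's `1∕4`) does not see that scale; the fine one does: in `e^{−iλ(z)}·W(z,ν)·e^{iλ(z+e_ν)}` only the
DIFFERENCE `λ(z+e_ν) − λ(z)` (= `η·∇λ`, (1.108)'s gradient part, `≤ α₄·L^{−k}` at the top level) and `‖W − 1‖` (`≤ e^{c₁} − 1`, `c₁ = L·c⋆·L^{−k}`, the datum's chart) enter.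

WHAT.  §1 ★ `norm_gaugeFixed_sub_one_le_fine` (any complete normed `ℂ`-algebra with `‖1‖ = 1`): `‖e^{−iλ(z)}·e^{iηA(z,ν)}·e^{iλ(z+e_ν)} − 1‖ ≤ e^{2α₄}·((e^{c} − 1) + δ)` for
`‖λ(z)‖, ‖λ(z+e_ν)‖ ≤ α₄`, `‖λ(z+e_ν) − λ(z)‖ ≤ δ`, `η‖A(z,ν)‖ ≤ c` (lit ✓`Literature.Analysis.Complex.norm_exp_sub_exp_le` ∕ `norm_exp_le_exp_norm`).
§2 ★★ `topReadsFull_of_datum` (the torus member, letters of ✓p657279 `topReads_of_datum` + the top step's `λ′`): for every torus bond `b` whose window representative lies in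
`□_k`, `‖(U♯)^{g′} b − 1‖ ≤ e^{2α₄}·((e^{c₁} − 1) + δ)` — from Theorem 4's chart with size on `□_k` (`hchartTop`, ✓p652002), `‖λ′‖ ≤ α₄` on `□₀` and `‖λ′(z+e_ν) − λ′(z)‖ ≤ δ`
on `□_k` (the composer reads both off ✓p654110's conjunct 4 = (1.108): `δ := α₄·L^{−k}` by lit ✓`eta_smul_covDerivFwd`), via ✓p655738 §1 at the gauge `u₁·e^{iλ′}` (✓p645427
`datumGuards_gaugeFixed`) and §1.  So ✓p645668's `hWf1` holds at `r := e^{2α₄}((e^{c₁} − 1) + α₄L^{−k})` once (G1)'s territory lemma turns its block condition into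
«representative in `□_k`» (✓p659622 `HalvingHSiteTorusBlocks.rep_mem_cube_top_of_mem`); `2r ≤ α₂L^{−k}` (`α₂ = 2L·c⋆ + 8α₄`) is a (N05-WINDOWS) line.
HONEST SCOPE: one triangle inequality; nothing of (1.42), Prop. 3, Theorem 4 or the stub is proved here; ✓p645668's `htop t`∕`hwin` remain the (h2) rows.

References: T. Bałaban, CMP **99** (1985) 75–102 [Balaban1985RegularSpaces] ((1.42) p.83, (1.84) p.90, (1.108) p.94, (1.131) p.99); CMP **102** (1985) 277–309 [Balaban1985Variational] ((152) p.301).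
-/

set_option autoImplicit false

noncomputable section

open scoped BigOperators Matrix.Norms.L2Operator
open NormedSpace
open Complex (I)

namespace Summit.QuantumFields.YangMills.Theorems.HalvingHSiteTopReadsFull

open Literature.MathematicalPhysics.QuantumFieldTheory.Balaban1983to89
open Literature.MathematicalPhysics.QuantumFieldTheory.Balaban1983to89.T3ContinuumYM3Torus
open B5Eq118OneStroke (iterBlockOf)
open B7Prop1Explicit renaming Site → LSite
open B7Prop1Explicit (e expUnit val_expUnit val_inv_expUnit)
open B7Prop2Explicit (unitaryUnits)
open B7Eq92Concrete (mgauge mgauge_apply Rc_one_apply)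
open B8Eq131Cubes (cube gs cube_anti)
open B8Eq131CubesAdmissible (add_mem_cube_of_mem_succ)
open B8Eq184Proof (gaugeExp cfgExp)
open B10Eq27TorusAxialLog (transl rel pull unitsField toUField suIncl gaugeActT)
open B15Eq112TorusCover (lift cover)
open P1FlatCoreCubeInclusion (transl_zero_eq_cover cover_lift_add_rel)
open HalvingP1FlatCoreSupplierLandau (norm_exp_sub_one_le_of_le)
open HalvingP1FlatCoreTopSizes (datumGuards_gaugeFixed)
open HalvingHSiteTopKnit (gaugeActT_descent_eq_of_mgauge_cube)
open Literature.Analysis.Complex (norm_exp_sub_exp_le norm_exp_le_exp_norm)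

/-! ## §1 The fine near-`1` of a gauge-fixed bond variable -/

section Fine

variable {d : ℕ} {𝔸 : Type*} [NormedRing 𝔸] [NormedAlgebra ℂ 𝔸] [CompleteSpace 𝔸] [NormOneClass 𝔸]

/-- ★ **THE FINE NEAR-`1` OF A GAUGE-FIXED BOND VARIABLE**: `‖e^{−iλ(z)}·e^{iηA(z,ν)}·e^{iλ(z+e_ν)} − 1‖ ≤ e^{2α₄}·((e^{c} − 1) + δ)` when `‖λ(z)‖, ‖λ(z+e_ν)‖ ≤ α₄`,
`‖λ(z+e_ν) − λ(z)‖ ≤ δ`, `η‖A(z,ν)‖ ≤ c` — only the gradient of `λ` and the size of `A` enter at first order. [cite: Balaban1985RegularSpaces, (1.84) p.90, (1.108) p.94] -/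
theorem norm_gaugeFixed_sub_one_le_fine {η : ℝ} (hη : 0 ≤ η) {A : LSite d → Fin d → 𝔸} {lam : LSite d → 𝔸} {α₄ c δ : ℝ}
    (z : LSite d) (ν : Fin d) (hl0 : ‖lam z‖ ≤ α₄) (hl1 : ‖lam (z + e ν)‖ ≤ α₄) (hdiff : ‖lam (z + e ν) - lam z‖ ≤ δ) (hAz : η * ‖A z ν‖ ≤ c) :
    ‖((mgauge (1 : LSite d → Fin d → 𝔸ˣ) (gaugeExp lam)⁻¹ (cfgExp η A) z ν : 𝔸ˣ) : 𝔸) - 1‖ ≤ Real.exp (2 * α₄) * ((Real.exp c - 1) + δ) := by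
  rw [mgauge_apply, Pi.one_apply, Pi.one_apply, Rc_one_apply, Pi.inv_apply, Pi.inv_apply, inv_inv, gaugeExp, gaugeExp, cfgExp,
    val_inv_expUnit, Units.val_mul, Units.val_mul, val_expUnit, val_expUnit, val_expUnit]
  -- the three factors and their sizes
  have hn0 : ‖I • lam z‖ ≤ α₄ := by rw [norm_smul, Complex.norm_I, one_mul]; exact hl0
  have hn1 : ‖I • lam (z + e ν)‖ ≤ α₄ := by rw [norm_smul, Complex.norm_I, one_mul]; exact hl1
  have ha : ‖exp (-(I • lam z))‖ ≤ Real.exp α₄ := (norm_exp_le_exp_norm _).trans (Real.exp_le_exp.2 (by rw [norm_neg]; exact hn0))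
  have hc : ‖exp (I • lam (z + e ν))‖ ≤ Real.exp α₄ := (norm_exp_le_exp_norm _).trans (Real.exp_le_exp.2 hn1)
  have hW : ‖exp (I • (η • A z ν)) - 1‖ ≤ Real.exp c - 1 :=
    norm_exp_sub_one_le_of_le (by rw [norm_smul, Complex.norm_I, one_mul, norm_smul, Real.norm_of_nonneg hη]; exact hAz)
  have hca : ‖exp (I • lam (z + e ν)) - exp (I • lam z)‖ ≤ δ * Real.exp α₄ := by
    refine (norm_exp_sub_exp_le _ _).trans (mul_le_mul ?_ (Real.exp_le_exp.2 (max_le hn1 hn0)) (by positivity) ((norm_nonneg _).trans hdiff))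
    rw [← smul_sub, norm_smul, Complex.norm_I, one_mul]; exact hdiff
  have hinv : exp (-(I • lam z)) * exp (I • lam z) = 1 := by
    rw [← val_expUnit (-(I • lam z)), ← val_expUnit (I • lam z), ← val_inv_expUnit, ← Units.val_mul, inv_mul_cancel, Units.val_one]
  -- `a⁻¹ W c − 1 = a⁻¹ (W − 1) c + a⁻¹ (c − a)`
  have hid : exp (-(I • lam z)) * exp (I • (η • A z ν)) * exp (I • lam (z + e ν)) - 1 =
      exp (-(I • lam z)) * (exp (I • (η • A z ν)) - 1) * exp (I • lam (z + e ν)) +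
        exp (-(I • lam z)) * (exp (I • lam (z + e ν)) - exp (I • lam z)) := by
    rw [mul_sub, mul_sub, sub_mul, hinv]; noncomm_ring
  rw [hid]
  have hα : 0 ≤ Real.exp α₄ := (Real.exp_pos _).le
  have hW0 : 0 ≤ Real.exp c - 1 := (norm_nonneg _).trans hW
  calc ‖exp (-(I • lam z)) * (exp (I • (η • A z ν)) - 1) * exp (I • lam (z + e ν)) + exp (-(I • lam z)) * (exp (I • lam (z + e ν)) - exp (I • lam z))‖
      ≤ ‖exp (-(I • lam z))‖ * ‖exp (I • (η • A z ν)) - 1‖ * ‖exp (I • lam (z + e ν))‖ + ‖exp (-(I • lam z))‖ * ‖exp (I • lam (z + e ν)) - exp (I • lam z)‖ :=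
        (norm_add_le _ _).trans (add_le_add ((norm_mul_le _ _).trans (mul_le_mul_of_nonneg_right (norm_mul_le _ _) (norm_nonneg _))) (norm_mul_le _ _))
    _ ≤ Real.exp α₄ * (Real.exp c - 1) * Real.exp α₄ + Real.exp α₄ * (δ * Real.exp α₄) := by gcongr
    _ = Real.exp (2 * α₄) * ((Real.exp c - 1) + δ) := by rw [two_mul, Real.exp_add]; ring

end Fine

/-! ## §2 At the torus member: the fully gauge-fixed field by the top cube -/

variable {F : T3Family} {n K : ℕ}

/-- ★★ **THE NEAR-`1` OF THE FULLY GAUGE-FIXED TORUS FIELD BY THE TOP CUBE** — see the module docstring: for every torus bond whose window representative lies in `□_k`,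
`‖(U♯)^{g′} b − 1‖ ≤ e^{2α₄}·((e^{c₁} − 1) + δ)`, `g′` the composite of the full gauge `u₁·e^{iλ′}` (✓p645668's `hWf1` radius at the member).
[cite: Balaban1985RegularSpaces, (1.42) p.83, (1.84) p.90, (1.108) p.94, (1.131) p.99; Balaban1985Variational, (152) p.301] -/
theorem topReadsFull_of_datum (hnK : n < K) (x₀ : Site (F.P K) 0) {a : LSite (F.P K).d} {M' ρ' : ℕ} (hρ'1 : 1 ≤ ρ')
    (ha : ∀ ν, a ν ≤ ((iterBlockOf (K - n) x₀ ν).val : ℤ) ∧ ((iterBlockOf (K - n) x₀ ν).val : ℤ) ≤ a ν + M' - 1)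
    (hroomW : 2 * ((F.P K).L ^ (K - n) * (M' + 1) + ρ' * gs (F.P K).L (K - n)) ≤ (F.P K).sitesPerDir 0)
    (U : GaugeField (F.P K) 0 (Matrix.specialUnitaryGroup (Fin 2) ℂ)) (gJ : GaugeTransf (F.P K) 0 (Matrix.specialUnitaryGroup (Fin 2) ℂ))
    -- Theorem 4's datum `(u₁, W, A)` and its chart with size on the top cube (✓p647313's `hchartTop`)
    {u₁ : LSite (F.P K).d → (Matrix (Fin 2) (Fin 2) ℂ)ˣ} {W : LSite (F.P K).d → Fin (F.P K).d → (Matrix (Fin 2) (Fin 2) ℂ)ˣ}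
    {A : LSite (F.P K).d → Fin (F.P K).d → Matrix (Fin 2) (Fin 2) ℂ}
    (hu₁ : ∀ x, u₁ x ∈ unitaryUnits (Matrix (Fin 2) (Fin 2) ℂ))
    (hW : mgauge (1 : LSite (F.P K).d → Fin (F.P K).d → (Matrix (Fin 2) (Fin 2) ℂ)ˣ) u₁ W = pull (unitsField (toUField (GaugeField.gaugeAct gJ U))) 0)
    {η c₁ : ℝ} (hη : 0 ≤ η)
    (hchartTop : ∀ z ∈ cube (F.P K).L a M' ρ' (K - n) (K - n), ∀ ν : Fin (F.P K).d, W z ν = cfgExp η A z ν ∧ η * ‖A z ν‖ ≤ c₁)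
    -- the top step's `λ′`: self-adjoint, `≤ α₄` on `□₀`, gradient `≤ δ` on `□_k` (both from ✓p654110's conjunct 4)
    {lam : LSite (F.P K).d → Matrix (Fin 2) (Fin 2) ℂ} {α₄ δ : ℝ} (hsa : ∀ x, IsSelfAdjoint (lam x))
    (hlam0 : ∀ z ∈ cube (F.P K).L a M' ρ' (K - n) 0, ‖lam z‖ ≤ α₄)
    (hgrad : ∀ z ∈ cube (F.P K).L a M' ρ' (K - n) (K - n), ∀ ν : Fin (F.P K).d, ‖lam (z + e ν) - lam z‖ ≤ δ) :
    ∀ b : PBond (F.P K) 0, lift (F.P K) x₀ + rel x₀ b.src ∈ cube (F.P K).L a M' ρ' (K - n) (K - n) →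
      ‖((gaugeActT (fun s => ((u₁ * gaugeExp lam) (lift (F.P K) x₀ + rel x₀ s))⁻¹ * Unitary.toUnits (suIncl (gJ s)) :
          GaugeTransf (F.P K) 0 (Matrix (Fin 2) (Fin 2) ℂ)ˣ) (unitsField (toUField U)) b : (Matrix (Fin 2) (Fin 2) ℂ)ˣ) : Matrix (Fin 2) (Fin 2) ℂ) - 1‖ ≤
        Real.exp (2 * α₄) * ((Real.exp c₁ - 1) + δ) := by
  letI : CStarAlgebra (Matrix (Fin 2) (Fin 2) ℂ) := {}
  intro b hzk
  -- the representative `z` of the source and its bond `⟨0 + z, ν⟩ = b`; both ends in `□₀`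
  set z : LSite (F.P K).d := lift (F.P K) x₀ + rel x₀ b.src with hzdef
  have hsrc : transl (0 : Site (F.P K) 0) z = b.src := by rw [transl_zero_eq_cover, hzdef, cover_lift_add_rel]
  have hb : b = ⟨transl (0 : Site (F.P K) 0) z, b.dir⟩ := by rw [hsrc]
  have hz0 : z ∈ cube (F.P K).L a M' ρ' (K - n) 0 := cube_anti (Nat.zero_le _) le_rfl hzk
  have hkk : K - n = (K - n - 1) + 1 := by omega
  have hzν1 : z + e b.dir ∈ cube (F.P K).L a M' ρ' (K - n) (K - n - 1) := by
    refine add_mem_cube_of_mem_succ (by omega) (hkk ▸ hzk) fun i => ?_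
    rw [B7Prop1Explicit.e_apply]
    have h1 : (1 : ℤ) ≤ ((ρ' * (F.P K).L ^ (K - n - 1) : ℕ) : ℤ) := by
      have : 1 ≤ ρ' * (F.P K).L ^ (K - n - 1) := Nat.one_le_iff_ne_zero.2 (Nat.mul_ne_zero (by omega) (pow_ne_zero _ (F.P K).L_pos.ne'))
      exact_mod_cast this
    split_ifs <;> simp only [abs_one, abs_zero] <;> linarith
  have hzν : z + e b.dir ∈ cube (F.P K).L a M' ρ' (K - n) 0 := cube_anti (Nat.zero_le _) (by omega) hzν1
  -- the full gauge carries the gauge-fixed datum field to `U′`; the descent identity on `□₀`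
  have hWV := (datumGuards_gaugeFixed (1 : LSite (F.P K).d → Fin (F.P K).d → (Matrix (Fin 2) (Fin 2) ℂ)ˣ)
    (pull (unitsField (toUField (GaugeField.gaugeAct gJ U))) 0) W u₁ lam hu₁ hsa hW).2
  have hid := gaugeActT_descent_eq_of_mgauge_cube x₀ ha hroomW U gJ (u₁ * gaugeExp lam) _ hWV hz0 b.dir hzν
  obtain ⟨hWz, hAz⟩ := hchartTop z hzk b.dir
  -- the gauge-fixed datum bond variable is the gauge-fixed chart bond variable at `(z, ν)`
  have hval : mgauge (1 : LSite (F.P K).d → Fin (F.P K).d → (Matrix (Fin 2) (Fin 2) ℂ)ˣ) (gaugeExp lam)⁻¹ W z b.dir =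
      mgauge (1 : LSite (F.P K).d → Fin (F.P K).d → (Matrix (Fin 2) (Fin 2) ℂ)ˣ) (gaugeExp lam)⁻¹ (cfgExp η A) z b.dir := by
    rw [mgauge_apply, mgauge_apply, hWz]
  rw [hb, hid, hval]
  exact norm_gaugeFixed_sub_one_le_fine hη z b.dir (hlam0 z hz0) (hlam0 (z + e b.dir) hzν) (hgrad z hzk b.dir) hAz

end Summit.QuantumFields.YangMills.Theorems.HalvingHSiteTopReadsFull

end
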